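import Mathlib
import HarnessLib
import HarnessLib.Audit
import Summits.Parity.Statement
import Literature.NumberTheory.Sieve.BombieriAsymptoticSieveShiftedPrimes
import Literature.NumberTheory.Sieve.SingularSeries

/-!
Route: PrimeDeterminantSeesaw

CLOSED (retired) 2026-08-15T13:50:22Z by operator:999:1257524 — reason: not-a-thesis: assembly does not conclude the sub-problem Statement — note: D-0027 §2.1 audit (human 2026-08-15: routes that do not decide the summit are removed): the assembly concludes `PairsHLTwo`, not the sub-problem statement; a NEW conforming route may be opened from the same idea (generated `closes : … → _root_.GeneralizedHardyLittlewood`).. The file is kept as the record of this route; refuted decls are indexed as negative knowledge (`ledger negatives`).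

# Route PrimeDeterminantSeesaw — under EH + a GEH-fragment, twin primes = central-window prime 2x2
matrices of determinant 2 (Bombieri's sieve applied on both coordinates)

It suffices to show X = X_hyp ∧ X_det. X_hyp (standard believed level hypotheses):
Elliott–Halberstam for the primes (tree decl) and level x^{1−ε}, for every ε, of the odd-restricted
moment convolutions m ↦ Σ_{cd=m+2} Λ(c)log^i c·Λ(d)log^j d in Bombieri's (A₂) form (a GEH-fragment,
decl ConvMomentLevelOne). X_det (the parity-sensitive input, crux CentralPrimeDeterminant): the
Λ-weighted number of PRIME 2×2 matrices (a c; b d) of determinant cd − ab = 2 with n = ab ≤ x and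
every entry in the central window [n^{1/3}, n^{2/3}] is ∼ (1/9)·𝔖({0,2})·x·log²x. Then Σ_{n≤N}
Λ(n)Λ(n+2) ∼ 𝔖({0,2})N (decl PairsHLTwo: the d = 1, t = 2, h = 2, fixed-shift content of GHL;
uniformity in the shift and general systems are NOT claimed — route DicksonFibration's frame).
Realises card prime-determinant-seesaw (spine; absorbs determinant-seesaw-eh-free). Second, EH-only
rung (crux CentralHyperbola): the central-window hyperbola count p₁p₂ + 2 = q is ∼ (1/3)·𝔖·x log x;
EH ∧ CentralHyperbola → PairsHLTwo is Debouzy's localised Bombieri sieve (support HyperbolaRung).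
Lean: `(Literature.NumberTheory.Sieve.LevelOfDistribution.ElliottHalberstam ∧ ConvMomentLevelOne) ∧
CentralPrimeDeterminant`

## Assembly
Pure real analysis given the decls: fix EH and ConvMomentLevelOne; TwoSidedLocalisation at β = β' =
1/3, γ = γ' = 2/3 gives cell(x) = (1/9)S(x)log²x + o(x log²x); CentralPrimeDeterminant gives cell(x)
= (1/9)𝔖 x log²x(1+o(1)); hence S(x) = 𝔖x + o(x); pass from x : ℝ (sums to ⌊x⌋) to N : ℕ and use
𝔖({0,2}) > 0 (singularSeries_pos_iff_holds, isAdmissibleTuple_pair) to get IsEquivalent. The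
alternative chains EH → CentralHyperbola → PairsHLTwo (HyperbolaRung) and SeesawIdentity (global,
unlocalised) are support. From PairsHLTwo to the conjunct GeneralizedHardyLittlewood one still needs
every even h, k-tuples / t-fold products (the same bookkeeping with a = Π_{i≥2}Λ(a_i m + b_i)) and
shift-uniformity (Siegel-consistent only for fixed h) — NOT claimed; route DicksonFibration's DimOne
→ Assembly is the frame for that.

Rationale: WHY THIS LINE. Bombieri's asymptotic sieve (BombieriRIMS1977 p.7, FriedlanderIwaniecPisa1978 Thm 1;
in tree and PROVED: Literature.NumberTheory.Sieve.Bombieri1976_asymptotic_sieve_holds,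
Bombieri1976_selbergFormula_holds, isBombieriSequence_shiftedPrimesCounting_two under EH) is a
seesaw: for a_m = Λ(m+2) it gives S(x)log x + Σ_{p₁p₂+2=q} log p₁ log p₂ log q ≈ 2𝔖x log x, one free
parameter s = S/(𝔖x) ∈ [0,2]
(Literature.NumberTheory.Sieve.bombieri_asymptotic_sieve_indeterminacy). Applying the same k = 2
theorem to a_m = Λ(m−2) and to a'_m = Λ₂(m+2) (level 1 for Λ log and Λ⋆Λ in APs: EH ∧ the
GEH-fragment) and eliminating gives the exact trade Σ_{n≤x}(Λ⋆Λ)(n)(Λ⋆Λ)(n+2) = S(x)log²x + o(x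
log²x): twins = prime matrices of determinant 2; with the distributional (vector (k₁,k₂)) form of
the theorem on both coordinates and a Bernstein squeeze (Debouzy2019, arXiv:1907.06393, who proves
the one-sided localisation under EH) every two-sided window cell is PROPORTIONAL to S:
cell_{[β,γ]×[β',γ']} = (γ−β)(γ'−β')S log²x + o(x log²x), while one-sided hyperbola cells are ∝ (2 −
s). So the parity-sensitive input can be paid at the CENTRAL cell, an all-prime, fully balanced,
symmetric multilinear equation — the shape where dispersion / Kloosterman technology lives
(BombieriFriedlanderIwaniecActa1986, DukeFriedlanderIwaniec1997) — instead of at a Möbius sum (route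
MobiusShiftedPrimes = Bombieri's k = 1 residual in the LOPSIDED range m ≤ x^ε; complementary
object). Imported areas: sieve axiomatics (Bombieri/Friedlander–Iwaniec), approximation theory
(Bernstein polynomials for localisation), bilinear forms with Kloosterman fractions as the intended
engine on the crux. Nearest theorems about the crux object: Evans2022 (E₂-twin correlations with
constant 𝔖(h) on average over shifts |h| ≤ H, H ≥ log^{19}X, one factor of size log^B X — lopsided,
MRT technology), GoldstonEtAl2008 (q_{n+1} − q_n ≤ 6 for E₂ numbers); fixed shift 2 with balanced
factors is untouched. Negatives index: empty.

RANKED CRUXES. #0 PairsHLTwo (target) — Hardy–Littlewood for twin primes, Λ-form: Σ_{n≤N} Λ(n)Λ(n+2)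
∼ 𝔖({0,2})·N (= TauberianTwins.PairsHL at h = 2 = conclusion of MobiusShiftedPrimes.Assembly). The
conclusion node of this route; only the fixed-shift h = 2 content of GHL. (why it might fail:
twin-prime strength; parity (Literature.Barriers.Parity.PrimePairParity,
bombieri_asymptotic_sieve_indeterminacy) blocks sieve deductions even on GEH; binary
(Literature.Barriers.Parity.CircleMethodBinaryBarrier).) [HardyLittlewood1923, GreenTao2010,
Polymath8b2014, BombieriRIMS1977]
#2 CentralPrimeDeterminant (crux) — central-window prime matrices of determinant 2 (card item r2,
localised): with W(n) := Σ_{ab=n, n^{1/3}≤a≤n^{2/3}} Λ(a)Λ(b) (both prime-power factors in the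
central window), Σ_{n≤x} W(n)·W(n+2) ∼ (1/9)·𝔖({0,2})·x·log²x — i.e. #{(p₁,p₂,q₁,q₂) primes, q₁q₂ −
p₁p₂ = 2, p₁p₂ ≤ x, all four in [n^{1/3},n^{2/3}]} weighted by Πlog has its Hardy–Littlewood
asymptotic (singular series of the pair = 𝔖({0,2}); window density (1/3)² from Σ_{a≤y}Λ(a)/a = log y
+ O(1)). [difficulty: open-problem] (why it might fail: ⟺ HL(2) under EH+GEH₂ (parity-complete);
every pairing/dispersion leaves prime PAIRS on lines averaged over a 2-parameter family (Type II for
E₂−2 = Harman p.286 shape); no family-averaged HL for line families is known (MRT: shifts only, H ≥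
x^{8/33}).) [Harman2007, BombieriFriedlanderIwaniecActa1986, DukeFriedlanderIwaniec1997,
MatomakiRadziwillTao2019, Evans2022, arXiv:2407.14368]
#3 CentralHyperbola (crux) — EH-only rung (card item r3, localised as in Debouzy2019): the
central-window hyperbola count p₁p₂ + 2 = q, Σ_{n≤x} W(n)·Λ(n+2) ∼ (1/3)·𝔖({0,2})·x·log x with W as
in CentralPrimeDeterminant. Under EH alone this is EQUIVALENT to PairsHLTwo (one-sided cells ∝ (2 −
s): Debouzy2019 Thm 2 with [β,γ] = [1/3,2/3]); three primes, one of them bare. [difficulty: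
open-problem] (why it might fail: ⟺ HL(2) under EH (Debouzy2019 Thm 2); primes in the bilinear set
{p₁p₂+2} with the bare prime q undetected by any Type-I/II input we have (Harman2007 p.286: "no Type
II information at all" for p+2); even q−2 ∈ E₂ i.o. is open (Chen gives P₂ only).) [Debouzy2019,
arXiv:1907.06393, Harman2007, BombieriRIMS1977, doi:10.4064/aa-28-2-177-193]
#9 ConvMomentLevelOne (support) — the GEH-fragment (named conjecture-strength hypothesis, filed for
bookkeeping; refuters/provers should not spend effort proving it): for all i, j ≥ 0 the sifted
sequence a_m = 1_{m odd}·Σ_{cd=m+2} Λ(c)log^i c·Λ(d)log^j d, with Bombieri's counting function A(x)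
= Σ_{m≤x} a_m and density 1_{(d,2)=1}/φ(d) (tree: shiftedPrimesDensity 2), satisfies Bombieri's (A₂)
at θ₀ = 1 (tree predicate SieveSequence.BombieriA2). The odd restriction is essential ((Λ⋆Λ) has
mass ≍ y on even numbers 2p, which would break (A₂) at d = 2). Follows in substance from Polymath's
GEH[θ] ∀θ<1 (tree: GeneralizedElliottHalberstam) plus EH for the pieces with one factor < x^ε;
beyond the large sieve (Literature.Barriers.Parity.LargeSieveLevelHalf) exactly as EH is.
[difficulty: open-problem] [Polymath8b2014, ElliottHalberstam1970, BombieriRIMS1977,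
FriedlanderIwaniecPisa1978]
#9 SeesawIdentity (support) — PROVABLE (the global seesaw; twins = prime matrices of determinant 2):
EH → ConvMomentLevelOne → Σ_{n≤x}(Λ⋆Λ)(n)(Λ⋆Λ)(n+2) − (log x)²·Σ_{n≤x}Λ(n)Λ(n+2) = o(x log²x).
Proof: Bombieri k = 2 (Bombieri1976_asymptotic_sieve_holds) for the three sequences Λ(m+2)
(isBombieriSequence_shiftedPrimesCounting_two), Λ(m−2) (same proofs, residue −2), Λ₂(m+2) =
Λ(m+2)log(m+2) + 1_{m odd}(Λ⋆Λ)(m+2) + negligible ((A₂) from EH by partial summation +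
ConvMomentLevelOne at i=j=0; (A₁),(A₅) = same density, proved; (A₃),(A₄) elementary, A'(x) ∼ 2x log
x); expand Λ₂ = Λ·log + Λ⋆Λ on both sides (prime powers, even parts O(x log x)), replace log n by
log x by partial summation (errors O(x log x) using ΣΛ(n)Λ(n+2) ≪ x, tree TwinSieveUpperBound 4),
eliminate: V22 = 4𝔖x log²x − V11 − V12 − V21, V12 ≈ log x·(2𝔖x log x − S log x) ≈ V21, V11 ≈ S
log²x. [difficulty: M] [BombieriRIMS1977, FriedlanderIwaniecPisa1978, Debouzy2019]
#9 TwoSidedLocalisation (support) — PROVABLE (two-sided localisation; the heavy support): EH →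
ConvMomentLevelOne → for all windows 0 ≤ β < γ ≤ 1, 0 ≤ β' < γ' ≤ 1: Σ_{n≤x}
W_{β,γ}(n)·W'_{β',γ'}(n+2) − (γ−β)(γ'−β')(log x)²·S(x) = o(x log²x), where W_{β,γ}(n) = Σ_{ab=n,
n^β≤a≤n^γ} Λ(a)Λ(b). Proof: Friedlander–Iwaniec's Theorem 1 (Bombieri) in VECTOR form (k₁,k₂) with
max ≥ 2 (FriedlanderIwaniecPisa1978 p.722; the tree vendors only scalar k — the vector form /
Bombieri's distribution theorem on P₂ is the part to formalise, or vendor Debouzy2019 Thm 1.1)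
applied to a = Λ(m∓2) (one-sided cells ∝ (2−s), any continuous test function via Bernstein squeeze
from the polynomial moments, positivity) and then to the moment sequences b^{(i,j)}_m = 1_{m
odd}(Λlog^i ⋆ Λlog^j)(m+2) (their P₁-parameter is 2 − s by the first step, so their P₂-cells are ∝ 2
− (2 − s) = s); sharp windows by monotone squeeze. β = β' = 0, γ = γ' = 1 is SeesawIdentity.
[difficulty: L] [FriedlanderIwaniecPisa1978, BombieriRIMS1977, Debouzy2019, arXiv:1907.06393]
#9 HyperbolaRung (support) — PROVABLE (the EH-only rung): EH → CentralHyperbola → PairsHLTwo. This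
is Debouzy2019 Thm 2 / Thm 2.9 (arXiv:1907.06393) with [β,γ] = [1/3,2/3]: under EH, S(X) + 3·Σ_{n≤X}
Λ(n+2) Σ_{d₁d₂=n, n^{1/3}≤d₁≤n^{2/3}} Λ(d₁)Λ(d₂)/log n = 2𝔖X(1+o(1)) (one-sided localisation of
Bombieri's sieve; read the printed constant 2𝔖₂X, 𝔖₂ = C₂, as 2𝔖({0,2})X = 4C₂X — it must agree with
Bombieri's Σ Λ(n+2)Λ₂(n) ∼ 4C₂X log X; grounder to confirm), then algebra (log n ↔ log x by partial
summation) and 𝔖 > 0 (singularSeries_pos_iff_holds). [difficulty: L] [Debouzy2019, arXiv:1907.06393,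
FriedlanderIwaniecPisa1978]

TWO-LAYER PLAN. Foreseen glued splits (nothing filed now): CentralPrimeDeterminant ⇐ TypeOnePart →
TypeTwoPart → CentralPrimeDeterminant after a Heath-Brown identity on one prime per side
(TypeOnePart = the determinant equation cd − ab = 2 with Λ-coefficients on a, c and smooth long b, d
in balanced boxes — DukeFriedlanderIwaniec1997 / BombieriFriedlanderIwaniecActa1986 dispersion,
expected provable for ac ≤ x^{1+1/40}; TypeTwoPart = bilinear Σξ_rη_s g(rs−2), g the E₂-window
weight — the genuinely open corner); TwoSidedLocalisation ⇐ OneSidedLocalisation (vendor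
FriedlanderIwaniecPisa1978 vector Theorem 1 or Debouzy2019 Thm 1.1 as a Literature fact) →
MomentSequencesAreBombieri (EH ∧ ConvMomentLevelOne ⇒ (A₁)–(A₅) for b^{(i,j)}) →
TwoSidedLocalisation; PairsHLTwo for every even h (same decls with 2 ↦ h, density 1_{(d,h)=1}/φ(d));
the EH-free rung of card determinant-seesaw-eh-free (Bombieri's two-sided finite-level bounds 1 ±
c_k at BV level, Ford2004 §1, doi:10.4064/aa-28-2-177-193, trading EH for finitely many balanced
hyperbola counts H_j, j ≤ k₀) as a later sibling crux; a LOWER-bound variant (liminf cell/(x log²x)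
> 0 ⇒ infinitely many twin primes under X_hyp).

KILL CRITERIA. CentralPrimeDeterminant or CentralHyperbola REFUTED (a proof that the central cell is
not ∼ its HL value) refutes HL(2) under EH+GEH₂ resp. EH — close `refuted:<Decl>` and hand the
witness to the negatives index (it would be a major result). TwoSidedLocalisation or SeesawIdentity
refuted as stated (coefficient/normalisation wrong, e.g. the even-m issue or the window coefficient
(γ−β)(γ'−β')) ⇒ restate (pivot, not close): the mechanism survives any constant fix.
ConvMomentLevelOne shown NOT to follow from GEH[θ] ∀θ<1 ⇒ restate it as the exact Polymath form. If
a refuter shows that every Heath-Brown corner of the central cell needs Type II for general bilinear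
forms at level > 3/4 (FordMaynardMinimalTypeII-type necessity) for ALL identity parameters, the
dispersion bet is dead: downgrade to dormant (the conditional equivalences remain as support for
other routes). PairsHLTwo proved elsewhere moots the route.

NOT DECOMPOSED YET. The Heath-Brown/Type-I–II decomposition of the central cell (layer-2 children
above); the (A₁)–(A₅) verifications for Λ(m−2) and the moment sequences (inside SeesawIdentity /
TwoSidedLocalisation proofs, helper lemmas via --supports); general even h, k-tuples, t-fold
products (Bombieri with a = ΠΛ(a_i m+b_i)); shift-uniformity (needs ¬UnboundedSiegelZeros-type
input; cards siegel-hardness-uniform-ghl); the EH-free finite-level rung; numerics.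

CHEAPEST FALSIFIER. (1) Grounder lookup, one afternoon: read Debouzy2019 §2.2–2.5 (arXiv:1907.06393
pp.18–25) and FriedlanderIwaniecPisa1978 Thm 1 (vector (k)) to confirm (a) the one-sided
localisation under EH with coefficient (γ−β) and constant 2𝔖({0,2}) = 4C₂ (the preprint prints 2C₂ —
if the preprint's constant were right, Bombieri's k=2 asymptotic in the tree would be off by 2, so
one of them dies immediately), (b) that her hypotheses (H₁)–(H₉) for f(n) = windowed (Λ⋆Λ)(n+2) are
exactly EH + ConvMomentLevelOne. (2) Numerics (script numerics/main.py in the planner folder, NOT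
run: compute socket absent this session): for x = 10⁷…10⁹, h = 2, 6: Bombieri ratios Σ
Λ₂(m)Λ(m±h)/(2𝔖A log x), ΣΛ₂(m)Λ₂(m+h)/(2𝔖A' log x) → 1; V22/V11 → 1; central cell/((1/9)𝔖x log²x)
and central hyperbola/((1/3)𝔖 x log x) drifting towards 1 at rate O(1/log x) — a ratio off by a
clean factor (2, 𝔖, 1/9 vs 2/9) kills the bookkeeping (restate), not the line.

NUMBERS. 𝔖({0,2}) = 2C₂ = 1.3203236…, C₂ = 0.6601618… (Debouzy's 𝔖₂ = C₂); Bombieri k=2 main terms: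
Σ_{m≤x}Λ₂(m)Λ(m+2) ∼ 4C₂ x log x, Σ Λ₂(m)Λ₂(m+2) ∼ 8C₂ x log²x (A'(x) ∼ 2x log x); window means:
W_{[β,γ]}(n) has model mean (γ−β)log n; central cell constant (1/3)²·𝔖; one-sided cells ∝ (2 − s),
two-sided ∝ s, s = S(x)/(𝔖x) ∈ [0,2] (Selberg/Bombieri indeterminacy). Known on the crux object:
Evans2022 Thm 1.1 (H ≥ log^{19+ε}X, P = log^{17+ε}X), Thm 1.4 (prime–E₂, H ≥ X^{1/6+ε});
GoldstonEtAl2008 (E₂ gaps ≤ 6); DFI 1997 saving (MN)^{−1/48} for bilinear Kloosterman fractions; MRT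
averaged HL needs H ≥ X^{8/33}. Items at open: 8 (target, 2 cruxes, 4 support, assembly).

DEFINITION REQUESTS. Later clean-up (not blocking; statements are inlined now): notion
`windowedPrimePairWeight β γ n = Σ_{ab=n, n^β≤a≤n^γ} Λ(a)Λ(b)` and `momentShiftedConvolution i j h`
as a SieveSequence (topic Summits/Parity/GeneralizedHardyLittlewood/Theorems); fact requests for the
Literature: Debouzy2019 Thm 1.1/Thm 2 (one-sided localisation under EH, with the constant checked),
FriedlanderIwaniecPisa1978 Theorem 1 in vector form (k₁,…,k_r), DukeFriedlanderIwaniec1997 Thm 2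
(bilinear Kloosterman fractions), Evans2022 Thm 1.1.

Novelty: Searches (2026-08-15): `ledger negatives --problem Parity` (0); all 4 route files of the sub + the 3
related cards (geh-rigidity-twin-table, determinant-moebius-core, determinant-seesaw-eh-free) read;
`lit search --source zbmath|s2|crossref` ×9 queries ("twin almost primes products of two primes
differing by 2 asymptotic", "Bombieri asymptotic sieve Selberg formula shifted primes",
"correlations almost primes E2 Hardy-Littlewood", "generalized Selberg formula sieve parity twin",
"au:Debouzy", "determinant equation prime entries", "P2 numbers twin asymptotic Selberg Lambda2",
"almost prime pairs differing by 2 Elliott-Halberstam", "localisation Bombieri asymptotic sieve":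
hits doi:10.4064/aa-28-2-177-193, arXiv:2102.12297 = Evans2022, arXiv:1907.06393 = Debouzy2019,
doi:10.2307/121035); `lit vsearch` ×3 (Harman2007 p.286, Cojocaru–Murty, MV2007 p.81); `lit read`
arXiv:2102.12297 pp.1–4 and arXiv:1907.06393 pp.1–5, 18–20 (full text held); `lit frontier Parity
--since 2020` (30 rows, nothing on Λ₂⊗Λ₂ / determinant seesaw); `lit galaxy search --star all` ×4
("p_1p_2 - p_3p_4 = 2", "twin almost primes Bombieri asymptotic sieve", "generalized Selberg
formula", "twins almost prime": 1 irrelevant hit, panama saturated twice); openalex/arxiv/s2 partly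
HTTP 429, local searchd down (recorded).
Nearest prior art found: Debouzy2019 (arXiv:1907.06393) Thm 2 — the ONE-SIDED localised seesaw under
EH (= this route's CentralHyperbola rung and HyperbolaRung, hence KNOWN as a reduction); Bombie  [refs: 10.4064/aa-28-2-177-193, 10.2307/121035, 2102.12297, 1907.06393, doi:10.4064/aa-28-2-177-193, doi:10.2307/121035, Evans2022, Debouzy2019, Harman2007, BombieriRIMS1977, FriedlanderIwaniecPisa1978]

Barriers (technique_class: asymptotic-sieve elliott-halberstam bilinear-forms): - technique_class: asymptotic-sieve elliott-halberstam bilinear-forms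
- Literature.Barriers.Parity.SelbergParityBarrier: used as the engine, not evaded — Type-I data (EH,
ConvMomentLevelOne) enter only through Bombieri's k ≥ 2 identities, which the barrier certifies as
the exact extent of Type-I knowledge (one free parameter s); the crux is the non-Type-I input and
Selberg's ghosts (s = 0, 2) give central cell = 0 resp. hyperbola = 0, so both cruxes are genuinely
parity-sensitive, not sieve deductions.
- Literature.Barriers.Parity.FordFixedLevelBarrier: level x^{1−ε} for EVERY ε is assumed (EH-type),
never a fixed level; the EH-free finite-level rung is deferred precisely because of Ford2004.
- Literature.Barriers.Parity.PrimePairParity: consistent — no weight-insertion-invariant deduction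
reaches the cruxes; the extra axiom is an asymptotic for an all-prime multilinear equation, outside
the schema's inputs (discrepancies of 1, Λ, α⋆β in APs), of the bilinear kind Polymath8b §8 isolates
as the only exit.
- Literature.Barriers.Parity.FordMaynardMinimalTypeII: APPLIES to CentralPrimeDeterminant —
detecting the bare primes b, d (or q) through identities needs Type II across wide ranges; it does
not evade it; the bet is that with all four variables in [x^{1/3},x^{2/3}] every identity corner is
a dispersion problem with factorable moduli and a free cofactor, and the honest residue (Type II for
E₂−2) is named as the layer-2 child where the line can die.
- Literature.Barriers.Parity

History (route lifecycle, newest last):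
- 2026-08-15T13:50:22Z · CLOSED retired — not-a-thesis: assembly does not conclude the sub-problem Statement (operator:999:1257524)

sub-problem: GeneralizedHardyLittlewood · status: closed(retired) · opened planner-plancard-Parity-GeneralizedHardyLittl-5dd377e0-0 2026-08-15T11:47:00Z · rev 0 · ledger route-Parity-PrimeDeterminantSeesaw
GENERATED by the gate from the ledger (D-0016/17). Provers cite these decls: `theorem foo : Summit.Parity.GeneralizedHardyLittlewood.Theses.PrimeDeterminantSeesaw.<Decl> := …` in Summits/Parity/GeneralizedHardyLittlewood/Theorems/<Name>.lean.
-/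

namespace Summit.Parity.GeneralizedHardyLittlewood.Theses.PrimeDeterminantSeesaw

open scoped BigOperators Topology Manifold Classical MeasureTheory ProbabilityTheory Matrix InnerProductSpace ComplexConjugate ContinuousMap
open Filter Set Function TopologicalSpace MeasureTheory

attribute [summit_statement] _root_.GeneralizedHardyLittlewood

/-- item stmt-Parity-6459 · target · rank 0 · closed · moot by None · by planner
why it might fail: twin-prime strength; parity (Literature.Barriers.Parity.PrimePairParity, bombieri_asymptotic_sieve_indeterminacy) blocks sieve deductions even on GEH; binary (Literature.Barriers.Parity.CircleMethodBinaryBarrier).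
sources: HardyLittlewood1923, GreenTao2010, Polymath8b2014, BombieriRIMS1977
[target] Hardy–Littlewood for twin primes, Λ-form: Σ_{n≤N} Λ(n)Λ(n+2) ∼ 𝔖({0,2})·N (=
TauberianTwins.PairsHL at h = 2 = conclusion of MobiusShiftedPrimes.Assembly). The conclusion node
of this route; only the fixed-shift h = 2 content of GHL. -/
@[route_item "route-Parity-PrimeDeterminantSeesaw"]
def PairsHLTwo : Prop :=
  Asymptotics.IsEquivalent Filter.atTop (fun N : ℕ => ∑ n ∈ Finset.Icc 1 N, ArithmeticFunction.vonMangoldt n * ArithmeticFunction.vonMangoldt (n + 2)) (fun N : ℕ => Literature.NumberTheory.Sieve.singularSeries ({0, 2} : Finset ℤ) * (N : ℝ))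

/-- item stmt-Parity-6460 · crux · rank 2 · closed · moot by None · by planner
why it might fail: ⟺ HL(2) under EH+GEH₂ (parity-complete); every pairing/dispersion leaves prime PAIRS on lines averaged over a 2-parameter family (Type II for E₂−2 = Harman p.286 shape); no family-averaged HL for line families is known (MRT: shifts only, H ≥ x^{8/33}).
sources: Harman2007, BombieriFriedlanderIwaniecActa1986, DukeFriedlanderIwaniec1997, MatomakiRadziwillTao2019, Evans2022, arXiv:2407.14368
[crux] central-window prime matrices of determinant 2 (card item r2, localised): with W(n) :=
Σ_{ab=n, n^{1/3}≤a≤n^{2/3}} Λ(a)Λ(b) (both prime-power factors in the central window), Σ_{n≤x}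
W(n)·W(n+2) ∼ (1/9)·𝔖({0,2})·x·log²x — i.e. #{(p₁,p₂,q₁,q₂) primes, q₁q₂ − p₁p₂ = 2, p₁p₂ ≤ x, all
four in [n^{1/3},n^{2/3}]} weighted by Πlog has its Hardy–Littlewood asymptotic (singular series of
the pair = 𝔖({0,2}); window density (1/3)² from Σ_{a≤y}Λ(a)/a = log y + O(1)). [difficulty:
open-problem] -/
@[route_item "route-Parity-PrimeDeterminantSeesaw"]
def CentralPrimeDeterminant : Prop :=
  Asymptotics.IsEquivalent Filter.atTop (fun x : ℝ => ∑ n ∈ Finset.Icc 1 ⌊x⌋₊, (∑ ab ∈ (Nat.divisorsAntidiagonal n).filter (fun ab : ℕ × ℕ => (n : ℝ) ^ (1 / 3 : ℝ) ≤ (ab.1 : ℝ) ∧ (ab.1 : ℝ) ≤ (n : ℝ) ^ (2 / 3 : ℝ)), ArithmeticFunction.vonMangoldt ab.1 * ArithmeticFunction.vonMangoldt ab.2) * (∑ cd ∈ (Nat.divisorsAntidiagonal (n + 2)).filter (fun cd : ℕ × ℕ => ((n + 2 : ℕ) : ℝ) ^ (1 / 3 : ℝ) ≤ (cd.1 : ℝ)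 ∧ (cd.1 : ℝ) ≤ ((n + 2 : ℕ) : ℝ) ^ (2 / 3 : ℝ)), ArithmeticFunction.vonMangoldt cd.1 * ArithmeticFunction.vonMangoldt cd.2)) (fun x : ℝ => (1 / 9 : ℝ) * Literature.NumberTheory.Sieve.singularSeries ({0, 2} : Finset ℤ) * x * Real.log x ^ 2)

/-- item stmt-Parity-6461 · crux · rank 3 · closed · moot by None · by planner
why it might fail: ⟺ HL(2) under EH (Debouzy2019 Thm 2); primes in the bilinear set {p₁p₂+2} with the bare prime q undetected by any Type-I/II input we have (Harman2007 p.286: "no Type II information at all" for p+2); even q−2 ∈ E₂ i.o. is open (Chen gives P₂ only).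
sources: Debouzy2019, arXiv:1907.06393, Harman2007, BombieriRIMS1977, doi:10.4064/aa-28-2-177-193
[crux] EH-only rung (card item r3, localised as in Debouzy2019): the central-window hyperbola count
p₁p₂ + 2 = q, Σ_{n≤x} W(n)·Λ(n+2) ∼ (1/3)·𝔖({0,2})·x·log x with W as in CentralPrimeDeterminant.
Under EH alone this is EQUIVALENT to PairsHLTwo (one-sided cells ∝ (2 − s): Debouzy2019 Thm 2 with
[β,γ] = [1/3,2/3]); three primes, one of them bare. [difficulty: open-problem] -/
@[route_item "route-Parity-PrimeDeterminantSeesaw"]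
def CentralHyperbola : Prop :=
  Asymptotics.IsEquivalent Filter.atTop (fun x : ℝ => ∑ n ∈ Finset.Icc 1 ⌊x⌋₊, (∑ ab ∈ (Nat.divisorsAntidiagonal n).filter (fun ab : ℕ × ℕ => (n : ℝ) ^ (1 / 3 : ℝ) ≤ (ab.1 : ℝ) ∧ (ab.1 : ℝ) ≤ (n : ℝ) ^ (2 / 3 : ℝ)), ArithmeticFunction.vonMangoldt ab.1 * ArithmeticFunction.vonMangoldt ab.2) * ArithmeticFunction.vonMangoldt (n + 2)) (fun x : ℝ => (1 / 3 : ℝ) * Literature.NumberTheory.Sieve.singularSeries ({0, 2} : Finset ℤ) * x * Real.log x)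

/-- item stmt-Parity-6462 · support · rank 9 · closed · moot by None · by planner
sources: Polymath8b2014, ElliottHalberstam1970, BombieriRIMS1977, FriedlanderIwaniecPisa1978
[support] the GEH-fragment (named conjecture-strength hypothesis, filed for bookkeeping;
refuters/provers should not spend effort proving it): for all i, j ≥ 0 the sifted sequence a_m =
1_{m odd}·Σ_{cd=m+2} Λ(c)log^i c·Λ(d)log^j d, with Bombieri's counting function A(x) = Σ_{m≤x} a_m
and density 1_{(d,2)=1}/φ(d) (tree: shiftedPrimesDensity 2), satisfies Bombieri's (A₂) at θ₀ = 1
(tree predicate SieveSequence.BombieriA2). The odd restriction is essential ((Λ⋆Λ) has mass ≍ y on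
even numbers 2p, which would break (A₂) at d = 2). Follows in substance from Polymath's GEH[θ] ∀θ<1
(tree: GeneralizedElliottHalberstam) plus EH for the pieces with one factor < x^ε; beyond the large
sieve (Literature.Barriers.Parity.LargeSieveLevelHalf) exactly as EH is. [difficulty: open-problem] -/
@[route_item "route-Parity-PrimeDeterminantSeesaw"]
def ConvMomentLevelOne : Prop :=
  ∀ i j : ℕ, ∀ A : Literature.NumberTheory.Sieve.SieveSequence, (∀ m : ℕ, A.a m = if m % 2 = 1 then ∑ cd ∈ Nat.divisorsAntidiagonal (m + 2), ArithmeticFunction.vonMangoldt cd.1 * Real.log cd.1 ^ i * (ArithmeticFunction.vonMangoldt cd.2 * Real.log cd.2 ^ j) else 0) → (∀ x : ℝ, A.size x = A.congrSum 1 x) → A.density = Literature.NumberTheory.Sieve.shiftedPrimesDensity 2 → A.BombieriA2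

/-- item stmt-Parity-6463 · support · rank 9 · closed · moot by None · by planner
sources: BombieriRIMS1977, FriedlanderIwaniecPisa1978, Debouzy2019
[support] PROVABLE (the global seesaw; twins = prime matrices of determinant 2): EH →
ConvMomentLevelOne → Σ_{n≤x}(Λ⋆Λ)(n)(Λ⋆Λ)(n+2) − (log x)²·Σ_{n≤x}Λ(n)Λ(n+2) = o(x log²x). Proof:
Bombieri k = 2 (Bombieri1976_asymptotic_sieve_holds) for the three sequences Λ(m+2)
(isBombieriSequence_shiftedPrimesCounting_two), Λ(m−2) (same proofs, residue −2), Λ₂(m+2) =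
Λ(m+2)log(m+2) + 1_{m odd}(Λ⋆Λ)(m+2) + negligible ((A₂) from EH by partial summation +
ConvMomentLevelOne at i=j=0; (A₁),(A₅) = same density, proved; (A₃),(A₄) elementary, A'(x) ∼ 2x log
x); expand Λ₂ = Λ·log + Λ⋆Λ on both sides (prime powers, even parts O(x log x)), replace log n by
log x by partial summation (errors O(x log x) using ΣΛ(n)Λ(n+2) ≪ x, tree TwinSieveUpperBound 4),
eliminate: V22 = 4𝔖x log²x − V11 − V12 − V21, V12 ≈ log x·(2𝔖x log x − S log x) ≈ V21, V11 ≈ S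
log²x. [difficulty: M] -/
@[route_item "route-Parity-PrimeDeterminantSeesaw"]
def SeesawIdentity : Prop :=
  Literature.NumberTheory.Sieve.LevelOfDistribution.ElliottHalberstam → ConvMomentLevelOne → (fun x : ℝ => (∑ n ∈ Finset.Icc 1 ⌊x⌋₊, (ArithmeticFunction.vonMangoldt * ArithmeticFunction.vonMangoldt) n * (ArithmeticFunction.vonMangoldt * ArithmeticFunction.vonMangoldt) (n + 2)) - Real.log x ^ 2 * ∑ n ∈ Finset.Icc 1 ⌊x⌋₊, ArithmeticFunction.vonMangoldt n * ArithmeticFunction.vonMangoldt (n + 2)) =o[Filter.atTop] fun x : ℝ => x * Real.log x ^ 2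

/-- item stmt-Parity-6464 · support · rank 9 · closed · moot by None · by planner
sources: FriedlanderIwaniecPisa1978, BombieriRIMS1977, Debouzy2019, arXiv:1907.06393
[support] PROVABLE (two-sided localisation; the heavy support): EH → ConvMomentLevelOne → for all
windows 0 ≤ β < γ ≤ 1, 0 ≤ β' < γ' ≤ 1: Σ_{n≤x} W_{β,γ}(n)·W'_{β',γ'}(n+2) − (γ−β)(γ'−β')(log
x)²·S(x) = o(x log²x), where W_{β,γ}(n) = Σ_{ab=n, n^β≤a≤n^γ} Λ(a)Λ(b). Proof: Friedlander–Iwaniec's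
Theorem 1 (Bombieri) in VECTOR form (k₁,k₂) with max ≥ 2 (FriedlanderIwaniecPisa1978 p.722; the tree
vendors only scalar k — the vector form / Bombieri's distribution theorem on P₂ is the part to
formalise, or vendor Debouzy2019 Thm 1.1) applied to a = Λ(m∓2) (one-sided cells ∝ (2−s), any
continuous test function via Bernstein squeeze from the polynomial moments, positivity) and then to
the moment sequences b^{(i,j)}_m = 1_{m odd}(Λlog^i ⋆ Λlog^j)(m+2) (their P₁-parameter is 2 − s by
the first step, so their P₂-cells are ∝ 2 − (2 − s) = s); sharp windows by monotone squeeze. β = β'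
= 0, γ = γ' = 1 is SeesawIdentity. [difficulty: L] -/
@[route_item "route-Parity-PrimeDeterminantSeesaw"]
def TwoSidedLocalisation : Prop :=
  Literature.NumberTheory.Sieve.LevelOfDistribution.ElliottHalberstam → ConvMomentLevelOne → ∀ β γ β' γ' : ℝ, 0 ≤ β → β < γ → γ ≤ 1 → 0 ≤ β' → β' < γ' → γ' ≤ 1 → (fun x : ℝ => (∑ n ∈ Finset.Icc 1 ⌊x⌋₊, (∑ ab ∈ (Nat.divisorsAntidiagonal n).filter (fun ab : ℕ × ℕ => (n : ℝ) ^ β ≤ (ab.1 : ℝ) ∧ (ab.1 : ℝ) ≤ (n : ℝ) ^ γ), ArithmeticFunction.vonMangoldt ab.1 * ArithmeticFunction.vonMangoldt ab.2) * (∑ cd ∈ (Nat.divisorsAntidiagonal (n + 2)).filter (fun cd : ℕ × ℕ => ((n + 2 : ℕ) : ℝ) ^ β' ≤ (cd.1 : ℝ) ∧ (cd.1 : ℝ) ≤ ((n + 2 : ℕ) : ℝ) ^ γ'), ArithmeticFunction.vonMangoldt cd.1 * ArithmeticFunction.vonMangoldt cd.2)) - (γ - β) * (γ' - β') * Real.log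 x ^ 2 * ∑ n ∈ Finset.Icc 1 ⌊x⌋₊, ArithmeticFunction.vonMangoldt n * ArithmeticFunction.vonMangoldt (n + 2)) =o[Filter.atTop] fun x : ℝ => x * Real.log x ^ 2

/-- item stmt-Parity-6465 · support · rank 9 · closed · moot by None · by planner
sources: Debouzy2019, arXiv:1907.06393, FriedlanderIwaniecPisa1978
[support] PROVABLE (the EH-only rung): EH → CentralHyperbola → PairsHLTwo. This is Debouzy2019 Thm 2
/ Thm 2.9 (arXiv:1907.06393) with [β,γ] = [1/3,2/3]: under EH, S(X) + 3·Σ_{n≤X} Λ(n+2) Σ_{d₁d₂=n,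
n^{1/3}≤d₁≤n^{2/3}} Λ(d₁)Λ(d₂)/log n = 2𝔖X(1+o(1)) (one-sided localisation of Bombieri's sieve; read
the printed constant 2𝔖₂X, 𝔖₂ = C₂, as 2𝔖({0,2})X = 4C₂X — it must agree with Bombieri's Σ
Λ(n+2)Λ₂(n) ∼ 4C₂X log X; grounder to confirm), then algebra (log n ↔ log x by partial summation)
and 𝔖 > 0 (singularSeries_pos_iff_holds). [difficulty: L] -/
@[route_item "route-Parity-PrimeDeterminantSeesaw"]
def HyperbolaRung : Prop :=
  Literature.NumberTheory.Sieve.LevelOfDistribution.ElliottHalberstam → CentralHyperbola → PairsHLTwo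

/-- item stmt-Parity-6466 · assembly · rank 1 · closed · moot by None · by planner
sources: BombieriRIMS1977, FriedlanderIwaniecPisa1978, Debouzy2019
[assembly] TwoSidedLocalisation → CentralPrimeDeterminant → ElliottHalberstam → ConvMomentLevelOne →
PairsHLTwo. -/
@[route_item "route-Parity-PrimeDeterminantSeesaw"]
def Assembly : Prop :=
  TwoSidedLocalisation → CentralPrimeDeterminant → Literature.NumberTheory.Sieve.LevelOfDistribution.ElliottHalberstam → ConvMomentLevelOne → PairsHLTwo

end Summit.Parity.GeneralizedHardyLittlewood.Theses.PrimeDeterminantSeesaw
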